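import Mathlib
import Summits.QuantumFields.YangMills.Theses.FemtoCutoffLadder
import Summits.QuantumFields.YangMills.Theorems.FemtoCutoffLadderFixedLatticeLawValleyGain

/-!
# SKELETON «Rate» v3 for the crux child `FixedLatticeLaw` (stmt-QuantumFields-23943 ≡ tree leaf `FemtoGapFixedLattice`, route `FemtoCutoffLadder`) —
# ONE STUB: the Born–Oppenheimer data WITH RATE at level one on every lattice of size `L ≥ 2` (VALLEY half PROVED; `L = 1` = crux ONE)

Lead seat `ym-line-fcl-p1` g4 (2026-08-28).  History: g2/g3 skeleton (sha 6ec5270754c4) = `stub_valleyGain` (RED's C3 text `ValleyGainAt L (β^{−1/40}) (β^{−17/20})` ∀L) +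
`stub_innerRate` (RED's C4 text at k = 1 with tolerance `e^{Cλ_b²}`, ∀L); g4 v2 replaced `stub_innerRate` by the Born–Oppenheimer data of the landed door
(`Theorems/FemtoCutoffLadderFixedLatticeLawInnerRateBO.lean`, p599058).  v3 (this file): `stub_valleyGain` is DISCHARGED — route RED's lane A landed the k = 0 FLOOR
(`valleyFloorAt_of_idealCmp_pow` p597156, `riccatiN_idealCmp_pow` p597574) and this seat's glue gives `valleyGainAt_ledger : 2 ≤ L → ValleyGainAt L (powScale (1/40))
(powScale (17/20))` (`Theorems/FemtoCutoffLadderFixedLatticeLawValleyGain.lean`); the `L = 1` clause of the leaf is crux ONE (`femtoGapOneSite_proof`), so no valley/inner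
text is needed there.  What remains is EXACTLY ONE registered stub:
* `stub_boRate : BORateAll` — for every `L ≥ 2`, eventually in `β` (`u = λ_b(L³β)`, `μ_j = levelValue su2Rep 1 (L³β) j`): a normalisation `N > 0` with the FLOOR WITH RATE
  `N μ₀ e^{−Cu²} ≤ λ₀(β,L)`, and for every bounded measurable gauge-invariant pair `G₀, G₁` supported in `{orbitDist < β^{−1/40}}` an ADIABATIC SPLIT `φᵢ` (lattice, bounded
  measurable; think `fᵢ ⊗ Ω_u`, `Ω_u` the dressed stiff Gaussian ground state over the slow constant mode `u`) and a PHYSICAL ONE-SITE pair `gᵢ` (think the twist-symmetrised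
  dressed slow profiles `e^{−V/2}fᵢ`, `V ≥ −Cu²` the relative stiff zero-point energy) with, for every combination (`χ = ψ − φ`):
  (P1) `2|⟨φ,χ⟩| ≤ Cu²(‖φ‖² + ‖χ‖²)`; (P3) `⟨χ,K_βχ⟩ ≤ (1 − gap)·Nμ₁·‖χ‖²`; (P4) `⟨φ,K_βχ⟩² ≤ Cu²(Nμ₁)²‖φ‖²‖χ‖²`;
  (P5) `⟨φ,K_βφ⟩ ≤ e^{Cu²}N⟨g,K^{(1)}_{L³β}g⟩ + Cu²·Nμ₁·‖φ‖²`; (P6) `‖g‖² ≤ e^{Cu²}‖φ‖²`.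
Composition (kernel-checked, in the TREE): `femtoGapFixedLattice_of_bo` (`…FixedLatticeLawValleyGain`) = door `innerRateAt_of_bo_pow` (one-site max–min on `g`, completed
square against the stiff gap, floor) + `valleyGainAt_ledger` + the `O(λ_b²)` onion/IMS endgame `femtoGapFixedLatticeAt_of_valley_innerRate` + crux ONE at `L = 1`.
HONEST FRAMING: `stub_boRate` is OPEN fixed-lattice semiclassics on `SU(2)^{3L³}` (= C4 of RED's COARSE(L) WITH a rate, in Born–Oppenheimer form: slice/background-gauge
coordinates near the trivial orbit, dressed stiff ground state and its gap, second-order slow–fast estimate; XL — RED sizes C4 at 30–40 files); femto rung R2b1 (RECORD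
label) — not infinite volume, not a mass gap, not Clay.  No summit is proved by this line.
-/

set_option autoImplicit false

noncomputable section

open MeasureTheory Real
open scoped BigOperators
open Literature.MathematicalPhysics.QuantumFieldTheory hiding SU2
open Literature.MathematicalPhysics.QuantumLattice
open Summit.QuantumFields.YangMills.Theorems.FemtoTransferGap
open Summit.QuantumFields.YangMills.Theorems.FemtoCutoffLadder
open Summit.QuantumFields.YangMills.Theses.FemtoCutoffLadder

namespace Summit.QuantumFields.YangMills.Cruxes.FixedLatticeLaw.Rate

/-- **BORN–OPPENHEIMER DATA WITH RATE at level one, on every lattice of size `L ≥ 2`** (inner scale `β^{−1/40}`): VERBATIM the hypothesis `hBO` of the landed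
`femtoGapFixedLattice_of_bo` (`Theorems/FemtoCutoffLadderFixedLatticeLawValleyGain.lean`) — floor with rate + adiabatic split (P1)(P3)(P4)(P5)(P6). -/
def BORateAll : Prop :=
  ∀ (L : ℕ) [NeZero L], 2 ≤ L →
      ∃ C gap βB : ℝ, 0 < gap ∧ ∀ β : ℝ, βB ≤ β →
        ∃ N : ℝ, 0 < N ∧
          N * levelValue su2Rep 1 ((L : ℝ) ^ 3 * β) 0 * Real.exp (-(C * bareLambda ((L : ℝ) ^ 3 * β) ^ 2)) ≤ levelValue su2Rep L β 0 ∧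
          ∀ G : Fin 2 → (GaugeConfig 3 L SU2 → ℝ),
            (∀ i, Measurable (G i)) → (∀ i, ∃ C' : ℝ, ∀ U, |G i U| ≤ C') →
            (∀ i (g : Site 3 L → SU2) (U : GaugeConfig 3 L SU2), G i (gaugeTransform g U) = G i U) →
            (∀ i U, G i U ≠ 0 → orbitDist U < powScale (1 / 40) β) →
            ∃ (φ : Fin 2 → (GaugeConfig 3 L SU2 → ℝ)) (g : Fin 2 → (GaugeConfig 3 1 SU2 → ℝ)),
              (∀ i, Measurable (φ i)) ∧ (∀ i, ∃ C' : ℝ, ∀ U, |φ i U| ≤ C') ∧ (∀ i, IsPhys (g i)) ∧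
              ∀ a : Fin 2 → ℝ,
                2 * |l2 (fun U => ∑ i, a i * φ i U) (fun U => ∑ i, a i * G i U - ∑ i, a i * φ i U)| ≤
                    C * bareLambda ((L : ℝ) ^ 3 * β) ^ 2 *
                      (l2 (fun U => ∑ i, a i * φ i U) (fun U => ∑ i, a i * φ i U) +
                        l2 (fun U => ∑ i, a i * G i U - ∑ i, a i * φ i U) (fun U => ∑ i, a i * G i U - ∑ i, a i * φ i U)) ∧
                qform su2Rep β (fun U => ∑ i, a i * G i U - ∑ i, a i * φ i U) (fun U => ∑ i, a i * G i U - ∑ i, a i * φ i U) ≤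
                    (1 - gap) * (N * levelValue su2Rep 1 ((L : ℝ) ^ 3 * β) 1) *
                      l2 (fun U => ∑ i, a i * G i U - ∑ i, a i * φ i U) (fun U => ∑ i, a i * G i U - ∑ i, a i * φ i U) ∧
                qform su2Rep β (fun U => ∑ i, a i * φ i U) (fun U => ∑ i, a i * G i U - ∑ i, a i * φ i U) ^ 2 ≤
                    C * bareLambda ((L : ℝ) ^ 3 * β) ^ 2 * (N * levelValue su2Rep 1 ((L : ℝ) ^ 3 * β) 1) ^ 2 *
                      (l2 (fun U => ∑ i, a i * φ i U) (fun U => ∑ i, a i * φ i U) *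
                        l2 (fun U => ∑ i, a i * G i U - ∑ i, a i * φ i U) (fun U => ∑ i, a i * G i U - ∑ i, a i * φ i U)) ∧
                qform su2Rep β (fun U => ∑ i, a i * φ i U) (fun U => ∑ i, a i * φ i U) ≤
                    Real.exp (C * bareLambda ((L : ℝ) ^ 3 * β) ^ 2) * N *
                        qform su2Rep ((L : ℝ) ^ 3 * β) (fun U => ∑ i, a i * g i U) (fun U => ∑ i, a i * g i U) +
                      C * bareLambda ((L : ℝ) ^ 3 * β) ^ 2 * (N * levelValue su2Rep 1 ((L : ℝ) ^ 3 * β) 1) *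
                        l2 (fun U => ∑ i, a i * φ i U) (fun U => ∑ i, a i * φ i U) ∧
                l2 (fun U => ∑ i, a i * g i U) (fun U => ∑ i, a i * g i U) ≤
                    Real.exp (C * bareLambda ((L : ℝ) ^ 3 * β) ^ 2) * l2 (fun U => ∑ i, a i * φ i U) (fun U => ∑ i, a i * φ i U)

/-- stub (the ONLY one; HARDEST; C4 of RED's COARSE(L) with a rate, in Born–Oppenheimer form): the adiabatic split (P1)(P3)(P4)(P5)(P6) + the floor with rate,
at level one, inner scale `β^{−1/40}`, on every lattice of size `L ≥ 2`. -/
theorem stub_boRate : BORateAll := by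
  sorry

/-- Kernel-checked composition (landed in the tree as `femtoGapFixedLattice_of_bo`): the stub gives the tree leaf `FemtoGapFixedLattice`
(VALLEY for `L ≥ 2` = `valleyGainAt_ledger`, PROVED; `L = 1` = crux ONE). -/
theorem femtoGapFixedLattice_of (hB : BORateAll) : FemtoGapFixedLattice :=
  femtoGapFixedLattice_of_bo hB

/-- ★ The crux child BY NAME (`FixedLatticeLaw` is `Iff.rfl`-equal to the leaf) from exactly the one declared stub. -/
theorem FixedLatticeLaw_holds_of_stubs : FixedLatticeLaw :=
  femtoGapFixedLattice_of stub_boRate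

end Summit.QuantumFields.YangMills.Cruxes.FixedLatticeLaw.Rate

end
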